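import Summits.QuantumFields.BalabanUV.T4Continuum.Support.RegionBoxStarTowerSocket
import Summits.QuantumFields.BalabanUV.T4Continuum.Support.StarCarrierPairingAssembly

/-!
# T⁴ programme, spine node NE2 (U1a), sub-row Δ1 «NE2⁰-Dirichlet» — THE BOX STAR TOWERS OF THE [B9]-FAITHFUL `U = 1` REGION OPERATOR
# `Δ_a(Ω₀)` CONVERGE AT RATE `(√L)⁻¹` WITH NO DISPLAYED BINDER (the final junction of the owner's cut (L) ∧ (B) ∧ (Bᵗ) ∧ (K))

NE2 formalisation swarm `b2b-balaban-t4-ne2-formalise-*`, LEAF PROVER 06 (gen 7), junction holder by owner ruling R40 (b) (journal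
2026-08-20 l.23184), file 3 of «Δ1-VEC-BT-TRACE»: this seat's file 3a `RegionBoxStarTowerSocket` (p243324 — the renormalised and compressed
box star towers at `(√L)⁻¹` modulo ONE socket, the rung-`≥ 1` Gaffney pairing of the local operator) with the socket plugged by leaf-01-g11's
P5b `StarCarrierPairingAssembly.hPW1_box` / `hPW1_rate_box` (on leaf-03-g8's P5a `StarCarrierComponentPairing.component_pairing_le`, leaf-01's
P4a/b/c and P5b-1 `StarCarrierMasterBudget`, leaf-02-g8's electric dictionary).  Every leaf of the cut is a theorem on coordinate boxes:
(P-W) rungs ≥ 1 (leaf-03-g8 / leaf-01-g10,g11), rung 0 (owner O15-g), (R-loc) (leaf-02-g8), (P-mass) (leaf-07-g8), (B) (leaf-05-g9),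
(Bᵗ) ⟸ (B) (this seat), (K) (leaf-01-g10); W1 (owner g14 + gen 5 of this lineage), interior W2 (leaf-07-g7), PF + W3̃ ⟺ W3 + zero-extension W2
in the linear class (gen 6 of this lineage), the resolvent split + assembly (owner O15-a/b/c).

 * **`hinjK_box`** — King's compressed injected law of the faithful `Δ_a(Ω₀)` on every coordinate box, `≤ Cinj·((√L)⁻¹)^k`, NO binder;
 * **`towerLimitRate_star_renorm_box`** — the renormalised box star tower converges at rate `(√L)⁻¹`, NO binder;
 * **`towerLimitRate_star_box`** — the compressed (King) box star tower converges at rate `(√L)⁻¹`, NO binder.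

WORDING OF RECORD (owner R40 (b)): «Δ1 VECTOR layer CLOSED ON COORDINATE BOXES at model level: the renormalised (and compressed) box star towers
of the [B9]-faithful U = 1 region operator Δ_a(Ω₀) converge at rate (√L)⁻¹ with explicit constants, NO displayed binder — W1, interior W2, W3
all theorems; rate (√L)⁻¹ is sharp for King's compressed planting (free-end term); NOT [B9] (3.16)/(3.23)–(3.27)/(3.42) as printed; NE2 NOT
proved».

HONEST FRAMING (T4-DAG p. 1).  Bookkeeping over landed modules ([folklore]); model level (`U = 1`, ONE region = a coordinate box of unit
blocks, ONE averaging scale, finite torus, linear layer, operator norm); constants OURS and crude (`Cinj` is a tower of closed-form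
expressions in `γ′`, `σ₀`, `γ⋆`, `CgIbox`, `Cbox`, `Lam`, `cGaf`); general unions of blocks (re-entrant contact) OPEN (owner R37 (e) /
O15-f); Δ1 as a T4-DAG sub-row NOT closed beyond boxes; NE2 (U1a) NOT proved; spine PROVED 0/9 unchanged; NOT [B9] (3.16)/(3.23)–(3.27)/(3.42)
as printed; NOT infinite volume / mass gap / Clay.  HONEST DEPENDENCY: continuum YM on T⁴ ⇐ BetaPertH ∧ nine spine estimates (0/9 proved);
BetaPertH ⇐ (D1) ∧ (D4) ∧ CAP+tail; G-an2-4 gates asym, D1 and NE2/3/4.  No `sorry`.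
-/

noncomputable section

open scoped BigOperators ComplexConjugate Matrix Matrix.Norms.L2Operator

namespace Summit.QuantumFields.BalabanUV.T4Continuum.RegionBoxStarTowerEnd

open Literature.MathematicalPhysics.QuantumFieldTheory.Balaban1983to89.B5Prop11Plancherel (Tor fine)
open Literature.MathematicalPhysics.QuantumFieldTheory.Balaban1983to89.B5G183RateUnitTower (lev)
open Summit.QuantumFields.BalabanUV.T4Continuum
open Summit.QuantumFields.BalabanUV.T4Continuum.CovariantAveragingTower (TowerLimitRate)
open Summit.QuantumFields.BalabanUV.T4Continuum.BackgroundResolventTower (Cpert)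
open Summit.QuantumFields.BalabanUV.T4Continuum.RegionGaugeFixedVector (regionDeltaA)
open Summit.QuantumFields.BalabanUV.T4Continuum.DirichletSubregionTowerOf (JpR QpR)
open Summit.QuantumFields.BalabanUV.T4Continuum.DirichletSubregionRenormTower (AnR)
open Summit.QuantumFields.BalabanUV.T4Continuum.DirichletStarVectorTower (starP gamStar)
open Summit.QuantumFields.BalabanUV.T4Continuum.RegionInteriorW2 (CgIbox)
open Summit.QuantumFields.BalabanUV.T4Continuum.RegionSliceCoerciveBoxTower (cW1box)
open Summit.QuantumFields.BalabanUV.T4Continuum.RegionStarGradientLinearBox (CgLin0 CgLin1)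
open Summit.QuantumFields.BalabanUV.T4Continuum.RegionBoxStarTowerSocket (CinjP hinjK_box_of_WPairing1 towerLimitRate_star_renorm_box_of_WPairing1
  towerLimitRate_star_box_of_WPairing1)
open Summit.QuantumFields.BalabanUV.T4Continuum.StarCarrierPairingAssembly (CP5 hPW1_box hPW1_rate_box)
open Summit.QuantumFields.BalabanUV.Beta.GAN24.DirichletBoxTwoLevel (IsCoordBox)

variable {d : ℕ} (L : ℕ) [NeZero L] (M : Fin d → ℕ) [hM : ∀ μ, NeZero (M μ)] (S : Tor M → Prop) [DecidablePred S] (a a' : ℝ)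

/-- the final constant of the compressed injected law on boxes: `CinjP` at leaf-01-g11's Gaffney constant `CP5 d L`. [folklore] -/
def Cinj (d L : ℕ) (a a' : ℝ) : ℝ := CinjP d L a a' (CP5 d L)

/-- **KING's COMPRESSED INJECTED LAW OF THE [B9]-FAITHFUL `U = 1` REGION OPERATOR ON EVERY COORDINATE BOX, NO DISPLAYED BINDER**
(`2 ≤ L`, `0 < a`, `0 < a′`): `‖G_{k+1}·JpR k − JpR k·G_k‖ ≤ Cinj·((√L)⁻¹)^k`. [folklore] -/
theorem hinjK_box (hL : 2 ≤ L) (hbox : IsCoordBox M S) (ha : 0 < a) (ha' : 0 < a') (k : ℕ) :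
    ‖(regionDeltaA (lev L (k + 1)) M a a' S)⁻¹ * JpR L M (starP L M S) k
        - JpR L M (starP L M S) k * (regionDeltaA (lev L k) M a a' S)⁻¹‖ ≤ Cinj d L a a' * ((Real.sqrt L)⁻¹) ^ k :=
  hinjK_box_of_WPairing1 L M S a a' hL hbox ha ha' (hPW1_rate_box (d := d) L).1 (hPW1_rate_box (d := d) L).2
    (fun k u v hk => hPW1_box L M S a hL hbox ha.le k u v hk) k

/-- **THE RENORMALISED STAR TOWER OF THE FAITHFUL `Δ_a(Ω₀)` ON EVERY COORDINATE BOX CONVERGES AT RATE `(√L)⁻¹`, NO DISPLAYED BINDER.**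
[folklore] -/
theorem towerLimitRate_star_renorm_box (hL : 2 ≤ L) (hbox : IsCoordBox M S) (ha : 0 < a) (ha' : 0 < a') :
    TowerLimitRate (AnR L M (starP L M S)) ((L : ℝ) ^ d) (fun k => (regionDeltaA (lev L k) M a a' S)⁻¹)
      (Cpert 0 (Real.sqrt (CgIbox d a' (cW1box d a a' 4) / 2 * (gamStar d a' (cW1box d a a' 4))⁻¹))
        (Real.sqrt L * Cinj d L a a' + (2 * (Real.sqrt L - 1)
          * Real.sqrt ((2 * (gamStar d a' (cW1box d a a' 4))⁻¹ + CgIbox d a' (cW1box d a a' 4)) * (gamStar d a' (cW1box d a a' 4))⁻¹))) 0 0 0)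
      ((Real.sqrt L)⁻¹) :=
  towerLimitRate_star_renorm_box_of_WPairing1 L M S a a' hL hbox ha ha' (hPW1_rate_box (d := d) L).1 (hPW1_rate_box (d := d) L).2
    (fun k u v hk => hPW1_box L M S a hL hbox ha.le k u v hk)

/-- **THE COMPRESSED (King) STAR TOWER OF THE FAITHFUL `Δ_a(Ω₀)` ON EVERY COORDINATE BOX CONVERGES AT RATE `(√L)⁻¹`, NO DISPLAYED BINDER.**
[folklore] -/
theorem towerLimitRate_star_box (hL : 2 ≤ L) (hbox : IsCoordBox M S) (ha : 0 < a) (ha' : 0 < a') :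
    TowerLimitRate (QpR L M (starP L M S)) ((L : ℝ) ^ d) (fun k => (regionDeltaA (lev L k) M a a' S)⁻¹)
      (Cpert 0 (2 * d * Real.sqrt ((CgLin0 d a a' + CgLin1 d a a') * L * (gamStar d a' (cW1box d a a' 4))⁻¹)) (Cinj d L a a') 0
        ((gamStar d a' (cW1box d a a' 4))⁻¹ + Real.sqrt (d * ((CgLin0 d a a' + CgLin1 d a a') * L) * (gamStar d a' (cW1box d a a' 4))⁻¹))
        0) ((Real.sqrt L)⁻¹) :=
  towerLimitRate_star_box_of_WPairing1 L M S a a' hL hbox ha ha' (hPW1_rate_box (d := d) L).1 (hPW1_rate_box (d := d) L).2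
    (fun k u v hk => hPW1_box L M S a hL hbox ha.le k u v hk)

end Summit.QuantumFields.BalabanUV.T4Continuum.RegionBoxStarTowerEnd

end
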